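import Literature.AnabelianGeometry.AbsoluteAnabelian.AbsAnabUnitsTransportHolds
import Literature.AnabelianGeometry.AbsoluteAnabelian.AbsAnabUnitsTransportOfBiAnabelian
import HarnessLib

/-!
# The unit group `k^×` of an MLF is group-theoretic (bi-anabelian form): `Γ_{k₁} ≅ Γ_{k₂} ⇒ k₁^× ≅ k₂^×`

S. Mochizuki, *The Absolute Anabelian Geometry of Hyperbolic Curves* (2004) [AbsAnab], Prop. 1.2.1
(iii) p. 10 ("`Im(K^×_i)` [...] preserved by `α`"), (vi) p. 10 (the `α`-equivariant identification of
multiplicative groups `K̄₁^× ⥲ K̄₂^×`); *Topics in Absolute Anabelian Geometry III* [AbsTopIII],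
Cor. 1.10 (ii)(d) p. 42 ("one constructs the image of the Kummer map `k^× ↪ H¹(G_k, μ_Ẑ(Π_X))`" —
i.e. the GROUP `k^×` is recovered from the profinite group `G_k`).

THIS PROOF-ONLY FILE (no definitions, no named facts; abc-iut layer L4, support of the FACT-LIST row
F-0395 `AbsTopIII.Cor_1_10_ii`) extracts from the tree's `α`-EQUIVARIANT UNITS TRANSPORT
`ψ̄ : K̄₁^× ⥲ K̄₂^×` (`Prop121vii.unitsTransport_holds`, abc-iut-L4-d3: the colimit of the level
isomorphisms `Art_{L₂}⁻¹ ∘ (α|_U)^{ab} ∘ Art_{L₁}` of local class field theory) its restriction to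
GALOIS-FIXED points:

* `Prop121vii.IsAlphaEquivariant.exists_unitsMulEquiv` — for ANY fields `K₁, K₂` of characteristic
  `0`, an isomorphism `α : Γ_{K₁} ≃ₜ* Γ_{K₂}` and an `α`-equivariant `ψ̄ : K̄₁^× ≃* K̄₂^×`, the fixed
  points correspond: there is `e : K₁^× ≃* K₂^×` with `ψ̄ ∘ ι₁ = ι₂ ∘ e` (`ι_i : K_i^× ↪ K̄_i^×`), since
  `(K̄_i^×)^{Γ_{K_i}} = K_i^×` (`exists_algebraMap_eq_of_forall_smul_eq`);
* `Prop121vii.nonempty_unitsMulEquiv_of_continuousMulEquiv` — **for MLFs `K₁, K₂` (valued form,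
  universe `0`), every isomorphism of profinite groups `Γ_{K₁} ≃ₜ* Γ_{K₂}` yields `K₁^× ≃* K₂^×`**:
  the unit group of an MLF is an invariant of its absolute Galois group.

HONEST SCOPE: this is the BI-anabelian shadow of [AbsTopIII] Cor. 1.10 (ii)(d); the MONO-anabelian
construction («`k^×` = the elements of Frobenius-integral degree in `G_k^ab`») is not addressed here.
`K₁ ≅ K₂` as FIELDS is NOT claimed (false in general: non-geometric isomorphisms of absolute Galois
groups of MLFs exist, [AbsTopIII] Rmk. 1.9.4).  Classical local class field theory (OUR kernel check);
nothing here bears on [IUTchIII] Cor. 3.12 or takes a side.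
-/

noncomputable section

namespace Literature.AnabelianGeometry.AbsoluteAnabelian

namespace Prop121vii

open Field ValuativeRel
open Literature.NumberTheory.GaloisRepresentations

universe u

/-! ### Fixed points of `Γ_K` in `K̄^×` and the transport `ψ̄` -/

section Fixed

variable {K₁ K₂ : Type u} [Field K₁] [Field K₂]

/-- The image of `K^×` in `K̄^×` is fixed by `Γ_K`. [cite: MochizukiAbsAnab2004, Prop 1.2.1 (iii) p.10] -/
theorem smul_unitsMap_algebraMap (K : Type u) [Field K] (c : Kˣ) (τ : absoluteGaloisGroup K) :
    τ • Units.map (algebraMap K (AlgebraicClosure K) : K →* AlgebraicClosure K) c =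
      Units.map (algebraMap K (AlgebraicClosure K) : K →* AlgebraicClosure K) c :=
  Units.ext (by
    rw [Units.coe_smul, Units.coe_map, MonoidHom.coe_coe, absoluteGaloisGroup.smul_def,
      AlgEquiv.commutes])

/-- The embedding `K^× ↪ K̄^×` is injective. [folklore] -/
private theorem unitsMap_algebraMap_injective (K : Type u) [Field K] :
    Function.Injective (Units.map (algebraMap K (AlgebraicClosure K) : K →* AlgebraicClosure K)) :=
  fun _ _ h => Units.ext ((algebraMap K (AlgebraicClosure K)).injective (congrArg Units.val h))

/-- **Galois-fixed points correspond under an `α`-equivariant `ψ̄`.**  For fields `K₁, K₂` of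
characteristic `0`, `α : Γ_{K₁} ≅ Γ_{K₂}` and an `α`-equivariant `ψ̄ : K̄₁^× ⥲ K̄₂^×` ("Galois-equivariant
with respect to `α`", [AbsAnab] Prop. 1.2.1 (vi)), there is a multiplicative isomorphism
`e : K₁^× ⥲ K₂^×` such that `ψ̄` restricted to `K₁^× = (K̄₁^×)^{Γ_{K₁}}` IS `e` (i.e. `ψ̄ ∘ ι₁ = ι₂ ∘ e`):
`ψ̄` carries `Γ_{K₁}`-fixed points onto `Γ_{K₂}`-fixed points (`IsAlphaEquivariant.smul_eq_iff`), and
`(K̄^×)^{Γ_K} = K^×` (`exists_algebraMap_eq_of_forall_smul_eq`).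
[cite: MochizukiAbsAnab2004, Prop 1.2.1 (iii) p.10] -/
theorem IsAlphaEquivariant.exists_unitsMulEquiv [CharZero K₁] [CharZero K₂]
    {α : absoluteGaloisGroup K₁ ≃ₜ* absoluteGaloisGroup K₂}
    {ψ : (AlgebraicClosure K₁)ˣ ≃* (AlgebraicClosure K₂)ˣ} (hψ : IsAlphaEquivariant α ψ) :
    ∃ e : K₁ˣ ≃* K₂ˣ, ∀ c : K₁ˣ,
      Units.map (algebraMap K₂ (AlgebraicClosure K₂) : K₂ →* AlgebraicClosure K₂) (e c) =
        ψ (Units.map (algebraMap K₁ (AlgebraicClosure K₁) : K₁ →* AlgebraicClosure K₁) c) := by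
  classical
  set ι₁ := Units.map (algebraMap K₁ (AlgebraicClosure K₁) : K₁ →* AlgebraicClosure K₁) with hι₁
  set ι₂ := Units.map (algebraMap K₂ (AlgebraicClosure K₂) : K₂ →* AlgebraicClosure K₂) with hι₂
  have hι₂inj : Function.Injective ι₂ := unitsMap_algebraMap_injective K₂
  -- `ψ (ι₁ c)` is `Γ_{K₂}`-fixed, hence comes from `K₂`
  have hfix : ∀ c : K₁ˣ, ∀ τ : absoluteGaloisGroup K₂, τ • ψ (ι₁ c) = ψ (ι₁ c) := fun c τ =>
    hψ.forall_smul_eq (fun σ => smul_unitsMap_algebraMap K₁ c σ) τ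
  have hex : ∀ c : K₁ˣ, ∃ d : K₂ˣ, ι₂ d = ψ (ι₁ c) := fun c => by
    obtain ⟨d, hd0, hd⟩ := exists_algebraMap_eq_of_forall_smul_eq K₂ (hfix c)
    exact ⟨Units.mk0 d hd0, Units.ext (by rw [hι₂, Units.coe_map, MonoidHom.coe_coe]; exact hd)⟩
  choose f hf using hex
  -- `f` is multiplicative (`ι₂` is injective)
  have hmul : ∀ a b : K₁ˣ, f (a * b) = f a * f b := fun a b =>
    hι₂inj (by rw [map_mul, hf, hf, hf, map_mul, map_mul])
  let F : K₁ˣ →* K₂ˣ := MonoidHom.mk' f hmul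
  have hF : ∀ c, F c = f c := fun _ => rfl
  -- `f` is bijective
  have hinj : Function.Injective F := by
    intro a b h
    rw [hF, hF] at h
    have h' := congrArg ι₂ h
    rw [hf, hf] at h'
    exact unitsMap_algebraMap_injective K₁ (ψ.injective h')
  have hsurj : Function.Surjective F := by
    intro d
    -- `ψ⁻¹ (ι₂ d)` is `Γ_{K₁}`-fixed
    have hw : ∀ σ : absoluteGaloisGroup K₁, σ • ψ.symm (ι₂ d) = ψ.symm (ι₂ d) := by
      intro σ
      have h := (hψ.smul_eq_iff (α σ) (ψ.symm (ι₂ d))).mp (by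
        rw [MulEquiv.apply_symm_apply]; exact smul_unitsMap_algebraMap K₂ d (α σ))
      rwa [ContinuousMulEquiv.symm_apply_apply] at h
    obtain ⟨c, hc0, hc⟩ := exists_algebraMap_eq_of_forall_smul_eq K₁ hw
    refine ⟨Units.mk0 c hc0, hι₂inj ?_⟩
    rw [hF, hf]
    have : ι₁ (Units.mk0 c hc0) = ψ.symm (ι₂ d) :=
      Units.ext (by rw [hι₁, Units.coe_map, MonoidHom.coe_coe]; exact hc)
    rw [this, MulEquiv.apply_symm_apply]
  exact ⟨MulEquiv.ofBijective F ⟨hinj, hsurj⟩, fun c => hf c⟩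

end Fixed

/-! ### MLFs: `Γ_{K₁} ≅ Γ_{K₂} ⇒ K₁^× ≅ K₂^×` -/

/-- **The unit group of an MLF is group-theoretic (bi-anabelian form).**  For non-archimedean local
fields `K₁, K₂` of characteristic `0` and an isomorphism of profinite groups `α : Γ_{K₁} ≃ₜ* Γ_{K₂}`
there is a multiplicative isomorphism `K₁^× ≃* K₂^×` — the restriction to Galois-fixed points of the
`α`-equivariant units transport `ψ̄ : K̄₁^× ⥲ K̄₂^×` of [AbsAnab] Prop. 1.2.1 (vi)
(`unitsTransport_holds`: colimit of `Art_{L₂}⁻¹ ∘ (α|_U)^{ab} ∘ Art_{L₁}`, local class field theory).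
This is the group `k^×` of [AbsTopIII] Cor. 1.10 (ii)(d) as an invariant of `G_k`.  (The fields
themselves need NOT be isomorphic: [AbsTopIII] Rmk. 1.9.4.)  Universe `0` (reach of
`unitsTransport_holds`). [cite: MochizukiAbsTopIII2015, Cor 1.10 (ii) p.42] -/
theorem nonempty_unitsMulEquiv_of_continuousMulEquiv (K₁ : Type) [Field K₁] [ValuativeRel K₁]
    [TopologicalSpace K₁] [IsNonarchimedeanLocalField K₁] [CharZero K₁] (K₂ : Type) [Field K₂]
    [ValuativeRel K₂] [TopologicalSpace K₂] [IsNonarchimedeanLocalField K₂] [CharZero K₂]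
    (α : absoluteGaloisGroup K₁ ≃ₜ* absoluteGaloisGroup K₂) : Nonempty (K₁ˣ ≃* K₂ˣ) := by
  obtain ⟨ψ, hψ, -, -⟩ := unitsTransport_holds K₁ K₂ α
  obtain ⟨e, -⟩ := hψ.exists_unitsMulEquiv
  exact ⟨e⟩

/-- The same with the compatibility retained: for MLFs `K₁, K₂` and `α : Γ_{K₁} ≃ₜ* Γ_{K₂}` there are
an `α`-equivariant `ψ̄ : K̄₁^× ⥲ K̄₂^×` preserving `𝒪^×` and uniformisers (`unitsTransport_holds`) AND
`e : K₁^× ≃* K₂^×` with `ψ̄ ∘ ι₁ = ι₂ ∘ e`. [cite: MochizukiAbsAnab2004, Prop 1.2.1 (vi) p.10] -/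
theorem exists_unitsTransport_and_unitsMulEquiv (K₁ : Type) [Field K₁] [ValuativeRel K₁]
    [TopologicalSpace K₁] [IsNonarchimedeanLocalField K₁] [CharZero K₁] (K₂ : Type) [Field K₂]
    [ValuativeRel K₂] [TopologicalSpace K₂] [IsNonarchimedeanLocalField K₂] [CharZero K₂]
    (α : absoluteGaloisGroup K₁ ≃ₜ* absoluteGaloisGroup K₂) :
    ∃ (ψ : (AlgebraicClosure K₁)ˣ ≃* (AlgebraicClosure K₂)ˣ) (e : K₁ˣ ≃* K₂ˣ),
      IsAlphaEquivariant α ψ ∧ PreservesAbsUnits ψ ∧ PreservesUniformizers ψ ∧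
        ∀ c : K₁ˣ,
          Units.map (algebraMap K₂ (AlgebraicClosure K₂) : K₂ →* AlgebraicClosure K₂) (e c) =
            ψ (Units.map (algebraMap K₁ (AlgebraicClosure K₁) : K₁ →* AlgebraicClosure K₁) c) := by
  obtain ⟨ψ, hψ, hU, hπ⟩ := unitsTransport_holds K₁ K₂ α
  obtain ⟨e, he⟩ := hψ.exists_unitsMulEquiv
  exact ⟨ψ, e, hψ, hU, hπ, he⟩

end Prop121vii

end Literature.AnabelianGeometry.AbsoluteAnabelian

end
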